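import Summits.FinalStateConjecture.FinalStateConjecture.Theorems.LaminatedThresholdCagedCombReduction
import Summits.FinalStateConjecture.FinalStateConjecture.Theorems.LaminatedThresholdCombLemmaAdapted

/-!
# Crux `LaminatedThreshold` (stmt-FinalStateConjecture-16893) · line `SketchIdeator1` (caged comb) —
# Stub 2 `stub_cagedCombCarrier` is the crux in naked costume: its dynamics is inert

Negative support lemmas for the PICKED line of the crux (refuter, cdisprove cycle 2, 2026-08-17). The line
(`Cruxes/LaminatedThreshold/Lines/SketchIdeator1.lean`) cuts the crux as
`LaminatedThreshold ⇐ comb_lemma_adapted → stub_cagedCombCarrier → stub_nakedNotSettled`, Stub 1 closed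
(`Comb.comb_lemma_adapted`, p157552), Stub 2 = "the physics" (a Banach space `E`, a `C¹` period map `T` of
`E × ℝ` with caged linearisation `(S, μ)`, `∃ N, ‖S ^ (N+1)‖ < 1 < μ`, invariant `t`-axis, a reading map `π`
of vacuum data continuous along local admissible families, transverse `C¹` seed sheets on both sides at
every scale, and the dictionary "orbit of `π (F c)` stays small or lands on a seed sheet ⇒ every MGHD of
`F c` carries a visible future-incomplete null ray"), Stub 3 = naked developments are not settled.

Write `Naked D` for the dictionary's conclusion (the inlined visible-incomplete-null-ray clause, for every
maximal vacuum Cauchy development of `D`) and call NAKED LAMINATION the statement obtained from the crux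
`LaminatedThreshold` by replacing "exceptional" (`¬ Good`) with `Naked` — same `∃ X d⋆ Φ K`, same two-sided
accumulation, same local-family clause. This file proves, with no physics and no named fact:

* `nakedLamination_of_stub_cagedCombCarrier` — **Stub 2 ⇒ naked lamination** (Stub 1 being a THEOREM, it is
  discharged here, not assumed: caged carrier ↦ adapted carrier of `T^[N+1]`
  (`CagedComb.adaptedCombCarrier_of_cagedCombCarrier`, p158743) ↦ comb chart `(Φ, K)` of
  `Comb.comb_lemma_adapted` ↦ `Φ ∘ π`; the base datum is naked by the constant family).
* `stub_cagedCombCarrier_of_nakedCombLamination` — **naked lamination on the MODEL COMB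
  `K₀ = {0} ∪ {±2⁻ⁿ}` ⇒ Stub 2**, by JUNK DYNAMICS: `E := ℝ`, `S := 0`, `μ := 2`, `T (e, t) := (0, 2t)`
  (linear, so `C¹`, `T 0 = 0`, linearisation `(0 ∘ fst, 2 • snd)`, `‖S ^ 1‖ = 0 < 1`, axis invariant),
  `π D := (0, Ψ D)`, seeds `σ₁ := 2⁻ᴺ < r`, `σ₂ := −2⁻ᴺ`, sheets `G₁ := snd − σ₁`, `G₂ := snd + σ₂‾` (affine,
  transverse), `ε₂ := 1`: the orbit of `(0, ψ)` is `(0, 2ⁿ ψ)`, it stays in the unit ball iff `ψ = 0` and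
  lands on a sheet iff `|ψ| = 2⁻ᴺ⁻ⁿ`, so the trichotomy holds only on `Ψ (F c) ∈ K₀`.

Consequences for the line (recorded in `Cruxes/LaminatedThreshold/Disproof.lean` §7, with the 5-line
composition `naked lamination → stub_nakedNotSettled → LaminatedThreshold`, which does not touch Stub 1):
(i) every clause of Stub 2 about `E, T, S, μ, r₀`, the cage `∃ N, ‖S ^ (N+1)‖ < 1` (in particular its
weakening of `‖S‖ < 1`), the axis clause and the seed sheets is satisfiable by the trivial linear model —
NONE of the dynamical hypotheses is load-bearing; the whole content of Stub 2 is the pair (reading map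
continuous along local families, nakedness dictionary), i.e. a lamination chart for NAKED data;
(ii) a general two-sided chart `(Φ, K)` is re-gauged onto the model comb by a strictly increasing continuous
`h` with `h (k±ₙ) = ±2⁻ⁿ` along sequences `k⁺ₙ ↓ Φ d⋆`, `k⁻ₙ ↑ Φ d⋆` in `K` (`Ψ := h ∘ Φ`; obligations only
shrink), so Stub 2 ⟺ naked lamination ⟺ naked lamination on `K₀`: the caged comb carrier is EQUIVALENT to
the crux with "exceptional" specialised to "naked", and the line reads
`LaminatedThreshold ⇐ NakedLamination ∧ NakedNotSettled` — Stub 1 (the only proved component), the cage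
lemma and the graph transform are logically inert; proving Stub 2 is proving the (naked) crux outright.
No definitions; every block is inlined verbatim from the line file.
-/

-- every `Summit.FinalStateConjecture.FinalStateConjecture.…` name repeats the summit = sub-problem segment (D-0017 layout)
set_option linter.dupNamespace false

noncomputable section

open Set Filter Metric Function Topology
open scoped Manifold ContDiff

namespace Summit.FinalStateConjecture.FinalStateConjecture.Theorems.LaminatedThreshold.Negative

open Literature.Geometry.Lorentzian

/-! ## Stub 2 ⇒ naked lamination (Stub 1 discharged as a theorem) -/

/-- **The caged vacuum comb carrier already IS a lamination chart for naked data.** From Stub 2 of line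
`SketchIdeator1` (hypothesis, verbatim `CagedCombLine.CagedCombCarrier`) follows the crux
`LaminatedThreshold` with "exceptional" replaced by "every MGHD carries a visible future-incomplete null
ray": the caged carrier is an adapted carrier for `T^[N+1]` (`CagedComb.adaptedCombCarrier_of_cagedCombCarrier`),
the PROVED adapted comb lemma (`Comb.comb_lemma_adapted`) charts it by `(Φ, K)`, the functional is `Φ ∘ π`,
and the base datum is naked along the constant family. Stub 3 is not used. [folklore] -/
theorem nakedLamination_of_stub_cagedCombCarrier
    (hC : ∃ (X : Type) (_ : TopologicalSpace X) (_ : ChartedSpace Literature.Geometry.Lorentzian.E3 X) (_ : IsManifold (𝓡 3) ((⊤ : ℕ∞) : WithTop ℕ∞) X) (_ : T2Space X) (_ : SecondCountableTopology X) (_ : ConnectedSpace X) (dstar : Literature.Geometry.Lorentzian.InitialDataSet (𝓡 3) X) (E : Type) (_ : NormedAddCommGroup E) (_ : NormedSpace ℝ E) (_ : CompleteSpace E) (T : E × ℝ → E × ℝ) (S : E →L[ℝ] E) (μ r₀ : ℝ) (π : Literature.Geometry.Lorentzian.InitialDataSet (𝓡 3) X → E × ℝ), dstar ∈ Literature.Geometry.Lorentzian.admissibleVacuumData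 X ∧ T 0 = 0 ∧ 0 < r₀ ∧ ContDiffOn ℝ 1 T (Metric.ball 0 r₀) ∧ HasFDerivAt T ((S.comp (ContinuousLinearMap.fst ℝ E ℝ)).prod (μ • ContinuousLinearMap.snd ℝ E ℝ)) 0 ∧ (∃ N : ℕ, ‖S ^ (N + 1)‖ < 1) ∧ 1 < μ ∧ (∀ t : ℝ, |t| < r₀ → (T ((0 : E), t)).1 = 0) ∧ π dstar = 0 ∧ (∀ F : EuclideanSpace ℝ (Fin 1) → Literature.Geometry.Lorentzian.InitialDataSet (𝓡 3) X, Literature.Geometry.Lorentzian.InitialDataSet.IsSmoothDataFamily 1 F → F 0 = dstar → (∀ c, F c ∈ Literature.Geometry.Lorentzian.admissibleVacuumData X) → (∃ C : Set X, IsCompact C ∧ ∀ c, ∀ x ∉ C, (F c).h.inner x = dstar.h.inner x ∧ (F c).k x = dstar.k x) → ∃ δ : ℝ, 0 < δ ∧ ContinuousOn (fun c ↦ π (F c)) (Metric.ball 0 δ)) ∧ ∀ r : ℝ, 0 < r → ∃ (σ₁ σ₂ ε₂ : ℝ) (G₁ G₂ : E × ℝ → ℝ), 0 < ε₂ ∧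 (0 < σ₁ ∧ σ₁ < r ∧ -r < σ₂ ∧ σ₂ < 0 ∧ (∃ r' : ℝ, 0 < r' ∧ ContDiffOn ℝ 1 G₁ (Metric.ball ((0 : E), σ₁) r') ∧ ContDiffOn ℝ 1 G₂ (Metric.ball ((0 : E), σ₂) r')) ∧ G₁ ((0 : E), σ₁) = 0 ∧ fderiv ℝ G₁ ((0 : E), σ₁) ((0 : E), (1 : ℝ)) ≠ 0 ∧ G₂ ((0 : E), σ₂) = 0 ∧ fderiv ℝ G₂ ((0 : E), σ₂) ((0 : E), (1 : ℝ)) ≠ 0) ∧ ∀ F : EuclideanSpace ℝ (Fin 1) → Literature.Geometry.Lorentzian.InitialDataSet (𝓡 3) X, Literature.Geometry.Lorentzian.InitialDataSet.IsSmoothDataFamily 1 F → F 0 = dstar → (∀ c, F c ∈ Literature.Geometry.Lorentzian.admissibleVacuumData X) → (∃ C : Set X, IsCompact C ∧ ∀ c, ∀ x ∉ C, (F c).h.inner x = dstar.h.inner x ∧ (F c).k x = dstar.k x) → ∃ δ : ℝ, 0 < δ ∧ ∀ c ∈ Metric.ball (0 : EuclideanSpace ℝ (Fin 1)) δ, ((∀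 n : ℕ, T^[n] (π (F c)) ∈ Metric.ball (0 : E × ℝ) ε₂) ∨ (∃ n : ℕ, T^[n] (π (F c)) ∈ Metric.ball ((0 : E), σ₁) ε₂ ∧ G₁ (T^[n] (π (F c))) = 0) ∨ (∃ n : ℕ, T^[n] (π (F c)) ∈ Metric.ball ((0 : E), σ₂) ε₂ ∧ G₂ (T^[n] (π (F c))) = 0)) → ∀ 𝒟 : Literature.Geometry.Lorentzian.VacuumCauchyDevelopment (F c), 𝒟.IsMaximal → ∀ [𝒟.metric.HasLeviCivita], ∃ (γ : ℝ → 𝒟.carrier) (dom : Set ℝ), (Literature.Geometry.Lorentzian.IsMaximalGeodesicOn 𝒟.metric.leviCivita γ dom ∧ (0 : ℝ) ∈ dom ∧ BddAbove dom ∧ (∀ t ∈ dom, 𝒟.metric.IsNull (Literature.Geometry.Lorentzian.velocity (𝓡 4) γ t) ∧ 𝒟.timeOrientation.IsFutureDirected (Literature.Geometry.Lorentzian.velocity (𝓡 4) γ t)) ∧ (∀ t ∈ dom, 0 ≤ t → (∃ (p : X) (δ' : ℝ → 𝒟.carrier) (s : Set ℝ), 𝒟.metric.IsNormalisedNullRayFrom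 𝒟.timeOrientation 𝒟.embed 𝒟.normal p δ' s ∧ ¬ BddAbove s ∧ γ t ∈ 𝒟.metric.chronologicalPast 𝒟.timeOrientation (δ' '' (s ∩ Set.Ici 0)))))) :
    ∃ (X : Type) (_ : TopologicalSpace X) (_ : ChartedSpace E3 X) (_ : IsManifold (𝓡 3) ∞ X)
      (_ : T2Space X) (_ : SecondCountableTopology X) (_ : ConnectedSpace X)
      (dstar : InitialDataSet (𝓡 3) X) (Φ : InitialDataSet (𝓡 3) X → ℝ) (K : Set ℝ),
      dstar ∈ admissibleVacuumData X ∧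
      (∀ 𝒟 : VacuumCauchyDevelopment dstar, 𝒟.IsMaximal → ∀ [𝒟.metric.HasLeviCivita],
        ∃ (γ : ℝ → 𝒟.carrier) (dom : Set ℝ), (IsMaximalGeodesicOn 𝒟.metric.leviCivita γ dom ∧ (0 : ℝ) ∈ dom ∧
          BddAbove dom ∧ (∀ t ∈ dom, 𝒟.metric.IsNull (velocity (𝓡 4) γ t) ∧
            𝒟.timeOrientation.IsFutureDirected (velocity (𝓡 4) γ t)) ∧
          (∀ t ∈ dom, 0 ≤ t → (∃ (p : X) (δ' : ℝ → 𝒟.carrier) (s : Set ℝ),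
            𝒟.metric.IsNormalisedNullRayFrom 𝒟.timeOrientation 𝒟.embed 𝒟.normal p δ' s ∧ ¬ BddAbove s ∧
              γ t ∈ 𝒟.metric.chronologicalPast 𝒟.timeOrientation (δ' '' (s ∩ Set.Ici 0)))))) ∧
      Φ dstar ∈ K ∧
      (∀ ε : ℝ, 0 < ε →
        (K ∩ Set.Ioo (Φ dstar - ε) (Φ dstar)).Nonempty ∧ (K ∩ Set.Ioo (Φ dstar) (Φ dstar + ε)).Nonempty) ∧
      ∀ F : EuclideanSpace ℝ (Fin 1) → InitialDataSet (𝓡 3) X,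
        InitialDataSet.IsSmoothDataFamily 1 F → F 0 = dstar → (∀ c, F c ∈ admissibleVacuumData X) →
        (∃ C : Set X, IsCompact C ∧
          ∀ c, ∀ x ∉ C, (F c).h.inner x = dstar.h.inner x ∧ (F c).k x = dstar.k x) →
        ∃ δ : ℝ, 0 < δ ∧ ContinuousOn (fun c ↦ Φ (F c)) (Metric.ball 0 δ) ∧
          ∀ c ∈ Metric.ball (0 : EuclideanSpace ℝ (Fin 1)) δ, Φ (F c) ∈ K →
            ∀ 𝒟 : VacuumCauchyDevelopment (F c), 𝒟.IsMaximal → ∀ [𝒟.metric.HasLeviCivita],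
              ∃ (γ : ℝ → 𝒟.carrier) (dom : Set ℝ), (IsMaximalGeodesicOn 𝒟.metric.leviCivita γ dom ∧ (0 : ℝ) ∈ dom ∧
                BddAbove dom ∧ (∀ t ∈ dom, 𝒟.metric.IsNull (velocity (𝓡 4) γ t) ∧
                  𝒟.timeOrientation.IsFutureDirected (velocity (𝓡 4) γ t)) ∧
                (∀ t ∈ dom, 0 ≤ t → (∃ (p : X) (δ' : ℝ → 𝒟.carrier) (s : Set ℝ),
                  𝒟.metric.IsNormalisedNullRayFrom 𝒟.timeOrientation 𝒟.embed 𝒟.normal p δ' s ∧ ¬ BddAbove s ∧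
                    γ t ∈ 𝒟.metric.chronologicalPast 𝒟.timeOrientation (δ' '' (s ∩ Set.Ici 0))))) := by
  obtain ⟨X, i₁, i₂, i₃, i₄, i₅, i₆, dstar, E, j₁, j₂, j₃, T, S, μ, r₀, π, hadm, hT0, hr₀, hT1, hTA, hS,
    hμ, haxis, hπ0, hcont, hseed⟩ := CagedComb.adaptedCombCarrier_of_cagedCombCarrier hC
  -- Stub 1 is a theorem: the adapted comb lemma's radius for this carrier
  obtain ⟨r₁, hr₁, hcomb⟩ := Comb.comb_lemma_adapted E T S μ r₀ hT0 hr₀ hT1 hTA hS hμ haxis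
  -- seeds on both sides at scale `r₁`, with the nakedness dictionary
  obtain ⟨σ₁, σ₂, ε₂, G₁, G₂, hε₂, hseeds, hdict⟩ := hseed r₁ hr₁
  -- the comb chart
  obtain ⟨ρ, hρ, Φ, K, hΦ0, hK0, hacc, hΦc, hsat⟩ := hcomb σ₁ σ₂ G₁ G₂ hseeds ε₂ hε₂
  -- the family clause, with nakedness as conclusion
  have hfam : ∀ F : EuclideanSpace ℝ (Fin 1) → InitialDataSet (𝓡 3) X, InitialDataSet.IsSmoothDataFamily 1 F →
      F 0 = dstar → (∀ c, F c ∈ admissibleVacuumData X) →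
      (∃ C : Set X, IsCompact C ∧ ∀ c, ∀ x ∉ C, (F c).h.inner x = dstar.h.inner x ∧ (F c).k x = dstar.k x) →
      ∃ δ : ℝ, 0 < δ ∧ ContinuousOn (fun c ↦ Φ (π (F c))) (Metric.ball 0 δ) ∧
        ∀ c ∈ Metric.ball (0 : EuclideanSpace ℝ (Fin 1)) δ, Φ (π (F c)) ∈ K →
          ∀ 𝒟 : VacuumCauchyDevelopment (F c), 𝒟.IsMaximal → ∀ [𝒟.metric.HasLeviCivita],
            ∃ (γ : ℝ → 𝒟.carrier) (dom : Set ℝ), (IsMaximalGeodesicOn 𝒟.metric.leviCivita γ dom ∧ (0 : ℝ) ∈ dom ∧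
              BddAbove dom ∧ (∀ t ∈ dom, 𝒟.metric.IsNull (velocity (𝓡 4) γ t) ∧
                𝒟.timeOrientation.IsFutureDirected (velocity (𝓡 4) γ t)) ∧
              (∀ t ∈ dom, 0 ≤ t → (∃ (p : X) (δ' : ℝ → 𝒟.carrier) (s : Set ℝ),
                𝒟.metric.IsNormalisedNullRayFrom 𝒟.timeOrientation 𝒟.embed 𝒟.normal p δ' s ∧ ¬ BddAbove s ∧
                  γ t ∈ 𝒟.metric.chronologicalPast 𝒟.timeOrientation (δ' '' (s ∩ Set.Ici 0))))) := by
    intro F hF h0 hFadm hCpt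
    obtain ⟨δ₁, hδ₁, hπc⟩ := hcont F hF h0 hFadm hCpt
    obtain ⟨δ₂, hδ₂, hnk⟩ := hdict F hF h0 hFadm hCpt
    -- `π ∘ F` is continuous at `0` and `π (F 0) = 0`, so small members are read inside `ball 0 ρ`
    have hat : ContinuousAt (fun c ↦ π (F c)) 0 :=
      (hπc 0 (Metric.mem_ball_self hδ₁)).continuousAt (Metric.ball_mem_nhds 0 hδ₁)
    have h00 : π (F 0) = 0 := by rw [h0, hπ0]
    have hpre : (fun c ↦ π (F c)) ⁻¹' Metric.ball (0 : E × ℝ) ρ ∈ 𝓝 (0 : EuclideanSpace ℝ (Fin 1)) := by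
      apply hat.preimage_mem_nhds
      rw [h00]
      exact Metric.ball_mem_nhds 0 hρ
    obtain ⟨δ₃, hδ₃, hball⟩ := Metric.mem_nhds_iff.1 hpre
    refine ⟨min δ₁ (min δ₂ δ₃), by positivity, ?_, ?_⟩
    · have hsub₁ : Metric.ball (0 : EuclideanSpace ℝ (Fin 1)) (min δ₁ (min δ₂ δ₃)) ⊆ Metric.ball 0 δ₁ :=
        Metric.ball_subset_ball (min_le_left _ _)
      have hsub₃ : Metric.ball (0 : EuclideanSpace ℝ (Fin 1)) (min δ₁ (min δ₂ δ₃)) ⊆ Metric.ball 0 δ₃ :=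
        (Metric.ball_subset_ball (min_le_right _ _)).trans (Metric.ball_subset_ball (min_le_right _ _))
      have hmaps : Set.MapsTo (fun c ↦ π (F c)) (Metric.ball (0 : EuclideanSpace ℝ (Fin 1)) (min δ₁ (min δ₂ δ₃)))
          (Metric.ball (0 : E × ℝ) ρ) := fun c hc ↦ hball (hsub₃ hc)
      exact hΦc.comp (hπc.mono hsub₁) hmaps
    · intro c hc hK
      have hc₂ : c ∈ Metric.ball (0 : EuclideanSpace ℝ (Fin 1)) δ₂ :=
        (Metric.ball_subset_ball ((min_le_right _ _).trans (min_le_left _ _))) hc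
      have hc₃ : c ∈ Metric.ball (0 : EuclideanSpace ℝ (Fin 1)) δ₃ :=
        (Metric.ball_subset_ball ((min_le_right _ _).trans (min_le_right _ _))) hc
      have hρc : π (F c) ∈ Metric.ball (0 : E × ℝ) ρ := hball hc₃
      exact hnk c hc₂ (hsat (π (F c)) hρc hK)
  refine ⟨X, i₁, i₂, i₃, i₄, i₅, i₆, dstar, fun D ↦ Φ (π D), K, hadm, ?_, ?_, ?_, ?_⟩
  · -- `d⋆` is naked: saturation along the constant family through `d⋆`
    obtain ⟨δ, hδ, -, hnaked⟩ := hfam (fun _ ↦ dstar) (InitialDataSet.isSmoothDataFamily_const 1 dstar)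
      rfl (fun _ ↦ hadm) ⟨∅, isCompact_empty, fun _ _ _ ↦ ⟨rfl, rfl⟩⟩
    have hmem : Φ (π dstar) ∈ K := by rw [hπ0, hΦ0]; exact hK0
    exact hnaked 0 (Metric.mem_ball_self hδ) hmem
  · -- `Φ (π d⋆) ∈ K`
    show Φ (π dstar) ∈ K
    rw [hπ0, hΦ0]; exact hK0
  · -- two-sided accumulation, transported along `Φ (π d⋆) = 0`
    intro ε hε
    show (K ∩ Set.Ioo (Φ (π dstar) - ε) (Φ (π dstar))).Nonempty ∧
      (K ∩ Set.Ioo (Φ (π dstar)) (Φ (π dstar) + ε)).Nonempty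
    rw [hπ0, hΦ0]
    exact hacc ε hε
  · -- the family clause
    intro F hF h0 hFadm hCpt
    exact hfam F hF h0 hFadm hCpt

/-! ## Naked lamination on the model comb ⇒ Stub 2, by junk dynamics -/

section Model

/-- The model period map `T (e, t) = (0, 2t)` on `ℝ × ℝ`, iterated on the axis: `Tⁿ (0, x) = (0, 2ⁿ x)`.
[folklore] -/
private theorem iterate_model (x : ℝ) (n : ℕ) :
    (fun p : ℝ × ℝ ↦ ((0 : ℝ), 2 * p.2))^[n] ((0 : ℝ), x) = ((0 : ℝ), 2 ^ n * x) := by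
  induction n with
  | zero => simp
  | succ n ih =>
    rw [Function.iterate_succ_apply', ih]
    show ((0 : ℝ), 2 * (2 ^ n * x)) = ((0 : ℝ), 2 ^ (n + 1) * x)
    rw [pow_succ]
    congr 1
    ring

/-- An axis orbit of the model map that stays in the unit ball for ever starts at `0`. [folklore] -/
private theorem eq_zero_of_forall_abs_lt_one {x : ℝ} (h : ∀ n : ℕ, |2 ^ n * x| < 1) : x = 0 := by
  by_contra hx
  have hpos : 0 < |x| := abs_pos.2 hx
  obtain ⟨n, hn⟩ := pow_unbounded_of_one_lt |x|⁻¹ (one_lt_two (α := ℝ))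
  have h1 : 1 < 2 ^ n * |x| := by
    have := mul_lt_mul_of_pos_right hn hpos
    rwa [inv_mul_cancel₀ hpos.ne'] at this
  have h2 : |2 ^ n * x| < 1 := h n
  rw [abs_mul, abs_pow, abs_two] at h2
  linarith

/-- An axis orbit of the model map that lands on the sheet `t = ±2⁻ᴺ` starts on the model comb.
[folklore] -/
private theorem abs_eq_pow_of_landing {x : ℝ} {N n : ℕ}
    (h : 2 ^ n * x = (2⁻¹ : ℝ) ^ N ∨ 2 ^ n * x = -(2⁻¹ : ℝ) ^ N) :
    |x| = (2⁻¹ : ℝ) ^ (N + n) := by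
  have h2n : (2 : ℝ) ^ n ≠ 0 := pow_ne_zero _ two_ne_zero
  have hσ : 0 < (2⁻¹ : ℝ) ^ N := pow_pos (by norm_num) N
  have habs : |2 ^ n * x| = (2⁻¹ : ℝ) ^ N := by
    rcases h with h | h
    · rw [h, abs_of_pos hσ]
    · rw [h, abs_neg, abs_of_pos hσ]
  rw [abs_mul, abs_pow, abs_two] at habs
  rw [pow_add, ← habs, inv_pow, mul_comm ((2 : ℝ) ^ n) |x|, mul_assoc, mul_inv_cancel₀ h2n, mul_one]

end Model

/-- **Naked lamination on the model comb gives the caged vacuum comb carrier, with JUNK dynamics.**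
Hypothesis: an admissible datum `d⋆` and a real reading `Ψ` of data, `Ψ d⋆ = 0`, continuous along every
local admissible family through `d⋆`, such that members read on the model comb
`K₀ = {0} ∪ {x | |x| = 2⁻ⁿ}` are naked (every MGHD carries a visible future-incomplete null ray).
Conclusion: Stub 2 of line `SketchIdeator1`, verbatim (`CagedCombLine.CagedCombCarrier`), witnessed by
`E := ℝ`, `S := 0`, `μ := 2`, `r₀ := 1`, `T (e, t) := (0, 2t)`, `π D := (0, Ψ D)`, and at scale `r` the seeds
`σ₁ := 2⁻ᴺ < r`, `σ₂ := −2⁻ᴺ`, `ε₂ := 1`, sheets `G₁ := snd − 2⁻ᴺ`, `G₂ := snd + 2⁻ᴺ`: the orbit of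
`(0, ψ)` is `(0, 2ⁿ ψ)`, which stays in the unit ball for ever iff `ψ = 0` and meets a sheet iff
`|ψ| = 2⁻ᴺ⁻ⁿ`. So no dynamical clause of Stub 2 (Banach space, `C¹` period map, cage
`∃ N, ‖S ^ (N+1)‖ < 1`, expansion `1 < μ`, invariant axis, transverse `C¹` seed sheets at all scales) is
load-bearing: all are met by the trivial linear model, and the stub's content is the continuous reading
plus the nakedness dictionary on a two-sided comb — the crux itself, for naked data. [folklore] -/
theorem stub_cagedCombCarrier_of_nakedCombLamination
    (h : ∃ (X : Type) (_ : TopologicalSpace X) (_ : ChartedSpace E3 X) (_ : IsManifold (𝓡 3) ∞ X)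
      (_ : T2Space X) (_ : SecondCountableTopology X) (_ : ConnectedSpace X)
      (dstar : InitialDataSet (𝓡 3) X) (Ψ : InitialDataSet (𝓡 3) X → ℝ),
      dstar ∈ admissibleVacuumData X ∧ Ψ dstar = 0 ∧
      ∀ F : EuclideanSpace ℝ (Fin 1) → InitialDataSet (𝓡 3) X,
        InitialDataSet.IsSmoothDataFamily 1 F → F 0 = dstar → (∀ c, F c ∈ admissibleVacuumData X) →
        (∃ C : Set X, IsCompact C ∧
          ∀ c, ∀ x ∉ C, (F c).h.inner x = dstar.h.inner x ∧ (F c).k x = dstar.k x) →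
        ∃ δ : ℝ, 0 < δ ∧ ContinuousOn (fun c ↦ Ψ (F c)) (Metric.ball 0 δ) ∧
          ∀ c ∈ Metric.ball (0 : EuclideanSpace ℝ (Fin 1)) δ, (Ψ (F c) = 0 ∨ ∃ n : ℕ, |Ψ (F c)| = (2⁻¹ : ℝ) ^ n) →
            ∀ 𝒟 : VacuumCauchyDevelopment (F c), 𝒟.IsMaximal → ∀ [𝒟.metric.HasLeviCivita],
              ∃ (γ : ℝ → 𝒟.carrier) (dom : Set ℝ), (IsMaximalGeodesicOn 𝒟.metric.leviCivita γ dom ∧ (0 : ℝ) ∈ dom ∧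
                BddAbove dom ∧ (∀ t ∈ dom, 𝒟.metric.IsNull (velocity (𝓡 4) γ t) ∧
                  𝒟.timeOrientation.IsFutureDirected (velocity (𝓡 4) γ t)) ∧
                (∀ t ∈ dom, 0 ≤ t → (∃ (p : X) (δ' : ℝ → 𝒟.carrier) (s : Set ℝ),
                  𝒟.metric.IsNormalisedNullRayFrom 𝒟.timeOrientation 𝒟.embed 𝒟.normal p δ' s ∧ ¬ BddAbove s ∧
                    γ t ∈ 𝒟.metric.chronologicalPast 𝒟.timeOrientation (δ' '' (s ∩ Set.Ici 0)))))) :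
    ∃ (X : Type) (_ : TopologicalSpace X) (_ : ChartedSpace Literature.Geometry.Lorentzian.E3 X) (_ : IsManifold (𝓡 3) ((⊤ : ℕ∞) : WithTop ℕ∞) X) (_ : T2Space X) (_ : SecondCountableTopology X) (_ : ConnectedSpace X) (dstar : Literature.Geometry.Lorentzian.InitialDataSet (𝓡 3) X) (E : Type) (_ : NormedAddCommGroup E) (_ : NormedSpace ℝ E) (_ : CompleteSpace E) (T : E × ℝ → E × ℝ) (S : E →L[ℝ] E) (μ r₀ : ℝ) (π : Literature.Geometry.Lorentzian.InitialDataSet (𝓡 3) X → E × ℝ), dstar ∈ Literature.Geometry.Lorentzian.admissibleVacuumData X ∧ T 0 = 0 ∧ 0 < r₀ ∧ ContDiffOn ℝ 1 T (Metric.ball 0 r₀) ∧ HasFDerivAt T ((S.comp (ContinuousLinearMap.fst ℝ E ℝ)).prod (μ • ContinuousLinearMap.snd ℝ E ℝ)) 0 ∧ (∃ N : ℕ, ‖S ^ (N + 1)‖ < 1) ∧ 1 < μ ∧ (∀ t : ℝ, |t| < r₀ → (T ((0 : E), t)).1 = 0) ∧ π dstar = 0 ∧ (∀ F : EuclideanSpace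 ℝ (Fin 1) → Literature.Geometry.Lorentzian.InitialDataSet (𝓡 3) X, Literature.Geometry.Lorentzian.InitialDataSet.IsSmoothDataFamily 1 F → F 0 = dstar → (∀ c, F c ∈ Literature.Geometry.Lorentzian.admissibleVacuumData X) → (∃ C : Set X, IsCompact C ∧ ∀ c, ∀ x ∉ C, (F c).h.inner x = dstar.h.inner x ∧ (F c).k x = dstar.k x) → ∃ δ : ℝ, 0 < δ ∧ ContinuousOn (fun c ↦ π (F c)) (Metric.ball 0 δ)) ∧ ∀ r : ℝ, 0 < r → ∃ (σ₁ σ₂ ε₂ : ℝ) (G₁ G₂ : E × ℝ → ℝ), 0 < ε₂ ∧ (0 < σ₁ ∧ σ₁ < r ∧ -r < σ₂ ∧ σ₂ < 0 ∧ (∃ r' : ℝ, 0 < r' ∧ ContDiffOn ℝ 1 G₁ (Metric.ball ((0 : E), σ₁) r') ∧ ContDiffOn ℝ 1 G₂ (Metric.ball ((0 : E), σ₂) r')) ∧ G₁ ((0 : E), σ₁) = 0 ∧ fderiv ℝ G₁ ((0 : E), σ₁) ((0 : E), (1 : ℝ)) ≠ 0 ∧ G₂ ((0 : E), σ₂) =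 0 ∧ fderiv ℝ G₂ ((0 : E), σ₂) ((0 : E), (1 : ℝ)) ≠ 0) ∧ ∀ F : EuclideanSpace ℝ (Fin 1) → Literature.Geometry.Lorentzian.InitialDataSet (𝓡 3) X, Literature.Geometry.Lorentzian.InitialDataSet.IsSmoothDataFamily 1 F → F 0 = dstar → (∀ c, F c ∈ Literature.Geometry.Lorentzian.admissibleVacuumData X) → (∃ C : Set X, IsCompact C ∧ ∀ c, ∀ x ∉ C, (F c).h.inner x = dstar.h.inner x ∧ (F c).k x = dstar.k x) → ∃ δ : ℝ, 0 < δ ∧ ∀ c ∈ Metric.ball (0 : EuclideanSpace ℝ (Fin 1)) δ, ((∀ n : ℕ, T^[n] (π (F c)) ∈ Metric.ball (0 : E × ℝ) ε₂) ∨ (∃ n : ℕ, T^[n] (π (F c)) ∈ Metric.ball ((0 : E), σ₁) ε₂ ∧ G₁ (T^[n] (π (F c))) = 0) ∨ (∃ n : ℕ, T^[n] (π (F c)) ∈ Metric.ball ((0 : E), σ₂) ε₂ ∧ G₂ (T^[n] (π (F c))) = 0)) → ∀ 𝒟 : Literature.Geometry.Lorentzian.VacuumCauchyDevelopment (F c),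 𝒟.IsMaximal → ∀ [𝒟.metric.HasLeviCivita], ∃ (γ : ℝ → 𝒟.carrier) (dom : Set ℝ), (Literature.Geometry.Lorentzian.IsMaximalGeodesicOn 𝒟.metric.leviCivita γ dom ∧ (0 : ℝ) ∈ dom ∧ BddAbove dom ∧ (∀ t ∈ dom, 𝒟.metric.IsNull (Literature.Geometry.Lorentzian.velocity (𝓡 4) γ t) ∧ 𝒟.timeOrientation.IsFutureDirected (Literature.Geometry.Lorentzian.velocity (𝓡 4) γ t)) ∧ (∀ t ∈ dom, 0 ≤ t → (∃ (p : X) (δ' : ℝ → 𝒟.carrier) (s : Set ℝ), 𝒟.metric.IsNormalisedNullRayFrom 𝒟.timeOrientation 𝒟.embed 𝒟.normal p δ' s ∧ ¬ BddAbove s ∧ γ t ∈ 𝒟.metric.chronologicalPast 𝒟.timeOrientation (δ' '' (s ∩ Set.Ici 0))))) := by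
  obtain ⟨X, i₁, i₂, i₃, i₄, i₅, i₆, dstar, Ψ, hadm, hΨ0, hfam⟩ := h
  refine ⟨X, i₁, i₂, i₃, i₄, i₅, i₆, dstar, ℝ, inferInstance, inferInstance, inferInstance,
    fun p ↦ ((0 : ℝ), 2 * p.2), 0, 2, 1, fun D ↦ ((0 : ℝ), Ψ D), hadm, ?_, one_pos, ?_, ?_, ⟨0, by simp⟩,
    one_lt_two, fun t _ ↦ rfl, ?_, ?_, ?_⟩
  · -- `T 0 = 0`
    simp
  · -- `C¹` (the junk period map is linear)
    exact (contDiff_const.prodMk (contDiff_const.mul contDiff_snd)).contDiffOn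
  · -- linearisation `(S ∘ fst, μ • snd) = (0, 2 • snd)` at `0`
    rw [ContinuousLinearMap.zero_comp]
    exact (hasFDerivAt_const (0 : ℝ) (0 : ℝ × ℝ)).prodMk (hasFDerivAt_snd.const_mul (2 : ℝ))
  · -- `π d⋆ = 0`
    show ((0 : ℝ), Ψ dstar) = 0
    rw [hΨ0]
    rfl
  · -- the reading is continuous along local admissible families
    intro F hF h0 hFadm hCpt
    obtain ⟨δ, hδ, hc, -⟩ := hfam F hF h0 hFadm hCpt
    exact ⟨δ, hδ, continuousOn_const.prodMk hc⟩
  · -- seeds at every scale, and the dictionary read on the model comb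
    intro r hr
    obtain ⟨N, hN⟩ := exists_pow_lt_of_lt_one hr (by norm_num : (2⁻¹ : ℝ) < 1)
    have hσ : 0 < (2⁻¹ : ℝ) ^ N := pow_pos (by norm_num) N
    have hG₁ : HasFDerivAt (fun p : ℝ × ℝ ↦ p.2 - (2⁻¹ : ℝ) ^ N) (ContinuousLinearMap.snd ℝ ℝ ℝ)
        ((0 : ℝ), (2⁻¹ : ℝ) ^ N) :=
      hasFDerivAt_snd.sub_const _
    have hG₂ : HasFDerivAt (fun p : ℝ × ℝ ↦ p.2 + (2⁻¹ : ℝ) ^ N) (ContinuousLinearMap.snd ℝ ℝ ℝ)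
        ((0 : ℝ), -(2⁻¹ : ℝ) ^ N) :=
      hasFDerivAt_snd.add_const _
    refine ⟨(2⁻¹ : ℝ) ^ N, -(2⁻¹ : ℝ) ^ N, 1, fun p ↦ p.2 - (2⁻¹ : ℝ) ^ N, fun p ↦ p.2 + (2⁻¹ : ℝ) ^ N,
      one_pos, ⟨hσ, hN, by linarith, by linarith, ⟨1, one_pos,
        (contDiff_snd.sub contDiff_const).contDiffOn, (contDiff_snd.add contDiff_const).contDiffOn⟩,
        by simp, ?_, by simp, ?_⟩, ?_⟩
    · rw [hG₁.fderiv]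
      simp
    · rw [hG₂.fderiv]
      simp
    · intro F hF h0 hFadm hCpt
      obtain ⟨δ, hδ, -, hsat⟩ := hfam F hF h0 hFadm hCpt
      refine ⟨δ, hδ, fun c hc htri ↦ hsat c hc ?_⟩
      -- the trichotomy holds only on the model comb
      rcases htri with hsmall | ⟨n, -, hn⟩ | ⟨n, -, hn⟩
      · refine Or.inl (eq_zero_of_forall_abs_lt_one fun n ↦ ?_)
        have h1 := hsmall n
        dsimp only at h1
        rw [iterate_model, mem_ball_zero_iff] at h1
        have h2 := (norm_snd_le _).trans_lt h1
        simpa [Real.norm_eq_abs] using h2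
      · have h1 : 2 ^ n * Ψ (F c) - (2⁻¹ : ℝ) ^ N = 0 := by
          have h := hn
          dsimp only at h
          rwa [iterate_model] at h
        exact Or.inr ⟨N + n, abs_eq_pow_of_landing (Or.inl (sub_eq_zero.1 h1))⟩
      · have h1 : 2 ^ n * Ψ (F c) + (2⁻¹ : ℝ) ^ N = 0 := by
          have h := hn
          dsimp only at h
          rwa [iterate_model] at h
        exact Or.inr ⟨N + n, abs_eq_pow_of_landing (Or.inr (eq_neg_of_add_eq_zero_left h1))⟩

end Summit.FinalStateConjecture.FinalStateConjecture.Theorems.LaminatedThreshold.Negative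

end
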